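import Summits.BirchSwinnertonDyer.BirchSwinnertonDyer.Theorems.KolyvaginDepthDoorKolyvaginDepthSupplyDoorOfPrint
import Summits.BirchSwinnertonDyer.BirchSwinnertonDyer.Theorems.KolyvaginDepthDoorKolyvaginDepthSupplyDoorNoTwist
import HarnessLib

/-!
# Route `KolyvaginDepthDoor`, crux `KolyvaginDepthSupply` (stmt-BirchSwinnertonDyer-21765) —
# the twist-free door ON THE CRUX'S OWN OBJECTS and with every Euler-system input BY NAME

Helper file (`--supports stmt-BirchSwinnertonDyer-21765 --as helper`); it closes nothing and BSD is
not proved by it.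

`…KolyvaginDepthSupplyDoorNoTwist` removed the twist point from the hF-free door in the abstract
currency (`door_of_hypothesesDepth`: Kolyvagin's eigen-bound `#Sel(E/K)_p^+ ≤ p^{ν+1}` read over `ℚ`
through the injective restriction `Sel_p(E/ℚ) ↪ Sel_p(E/K)^+`, file `SelmerTorsionRestriction`). This
file re-issues g5's system / print doors in that form:

* `shaCorank_eq_zero_of_kolyvaginClass_ne_zero_of_rank_le_of_system` — the setting of
  `exists_hypothesesDepth_of_system` (file `…DoorOfSystem`: a SYSTEM `d n : KolyvaginHeegnerData Dt β ι n`,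
  classes `(d n).kolyvaginClass hp 1 ∈ H¹(K, E[p^1])`, Zhang's Kolyvagin primes, the Euler-system /
  duality inputs `hτc`, `hfin`, `hinf`, `h44`, `hcyc`, `hdual` as displayed hypotheses, Čebotarev a
  tree theorem): `(d n₁).kolyvaginClass hp 1 ≠ 0` at depth `ν₁` and `ν₁ + 1 ≤ rank E(ℚ)` ⟹
  `t_p(E) = 0`, `rank E(ℚ) = ν₁ + 1`, `rank E^{(d_K)}(ℚ) ≤ ν₁`, `E(ℚ)[p] = 0`, `Ш(E/ℚ)[p] = 0`,
  `#Sel_p(E/ℚ) = p^{ν₁+1}` — g5's `shaCorank_eq_zero_of_kolyvaginClass_ne_zero_of_points_of_system`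
  WITHOUT `b ≤ rank E^{(d_K)}(ℚ)`;
* `shaCorank_eq_zero_of_two_le_rank_of_kolyvaginClass_prime_ne_zero_of_system` — the depth-table row
  on the crux's objects: the bit at ONE Kolyvagin prime + `2 ≤ rank E(ℚ)`, no twist point;
* `shaCorank_eq_zero_of_two_le_rank_of_kolyvaginClass_prime_ne_zero_of_print` — the same with the six
  hypotheses DISCHARGED BY NAME from the McCallum 1991 facts for the concrete classes (table of
  `…DoorOfPrint`: `sign_conjAct_kolyvaginClass`, `lemma43_kolyvaginClass_mem_selmerLocalKer`,
  `prop44_localOrder_kolyvaginClass_mul_eq`, `lemma53_selmer_eigen_dependent_at`,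
  `prop22_reciprocity_eigen_finset`) for a COMPATIBLE system (`hσ`, `hS₁`, `hS₂`, `hemb`) — g5's
  `shaCorank_eq_zero_of_rank_two_of_kolyvaginClass_prime_ne_zero_of_print` WITHOUT
  `1 ≤ rank E^{(d_K)}(ℚ)`.

Trust base: exactly that of `…DoorOfSystem` / `…DoorOfPrint` MINUS the rational point on the twist
(the new input, restriction + eigenspaces, is the PROVED Literature file `SelmerTorsionRestriction`).
Per-curve; conditional on the displayed hypotheses / five named facts; BSD is not proved by it.

References: [Kolyvagin1991MathAnn] Thm. 2.3; [GrossLMS1991] §5 (5.1), §10; [McCallumLMS1991] §§2–5;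
[SilvermanAEC2009] X.4.2; [JetchevLauterStein2009] §3.6.
-/

set_option linter.dupNamespace false

noncomputable section

open scoped Classical

namespace Summit.BirchSwinnertonDyer.BirchSwinnertonDyer.Theorems.KolyvaginDepthDoor

open Literature.NumberTheory.EllipticCurves Literature.NumberTheory.EllipticCurves.ModularForms
  Literature.NumberTheory.EllipticCurves.KolyvaginDescent
  Literature.NumberTheory.EllipticCurves.McCallum1991 WeierstrassCurve NumberField IsDedekindDomain

section System

variable {W : WeierstrassCurve ℚ} [W.IsElliptic] [W.IsGloballyMinimal] [NeZero (W.conductorNorm ℤ)]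
  {K : Type} [Field K] [NumberField K]
  {Dt : ModularParametrizationData W (W.conductorNorm ℤ)} {β : ℤ} {ι : K →+* ℂ}

/-- **The twist-free door on the crux's objects (first rank clause, any depth).** In the setting of
`exists_hypothesesDepth_of_system` (`E/ℚ` globally minimal without CM, `K` imaginary quadratic with
complex conjugation `c`, `p` odd with `ρ̄_{E,p^n}` onto for all `n`, a system `d` of
Kolyvagin–Heegner data over a frame `(Dt, β, ι)`, and the displayed Euler-system / duality
hypotheses `hτc`, `hfin`, `hinf`, `h44`, `hcyc`, `hdual`): if `(d n₁).kolyvaginClass hp 1 ≠ 0` for a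
square-free product `n₁` of Kolyvagin primes (Zhang's form) with `ν₁` prime factors and
`ν₁ + 1 ≤ rank E(ℚ)`, then `corank_{ℤ_p} Ш(E/ℚ)[p^∞] = 0`, `rank E(ℚ) = ν₁ + 1`,
`rank E^{(d_K)}(ℚ) ≤ ν₁`, `#E(ℚ)[p] = 1`, `Ш(E/ℚ)[p] = 0` and `#Sel_p(E/ℚ) = p^{ν₁+1}` (index `p^1`)
— `door_of_hypothesesDepth` at `m = p^1`. NO point on the twist. CONDITIONAL on the displayed
hypotheses; per-curve; BSD is not proved by it. [cite: Kolyvagin1991MathAnn, Thm. 2.3]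
[cite: GrossLMS1991, §5 (5.1) and §10] [cite: McCallumLMS1991, Cor. 3.2, Lemma 4.3, Prop. 4.4] -/
theorem shaCorank_eq_zero_of_kolyvaginClass_ne_zero_of_rank_le_of_system (hcm : ¬ W.HasCM)
    (hK : IsImaginaryQuadratic K) (p : ℕ) [hp : Fact p.Prime] (hp2 : p ≠ 2)
    (htower : ∀ n : ℕ, W.HasSurjectiveModNGaloisRep (p ^ n : ℕ))
    (c : K ≃ₐ[ℚ] K) (hc : c ≠ 1) (hcc : c * c = 1)
    (d : ∀ n : ℕ, KolyvaginHeegnerData Dt β ι n) (ε : ℤ) (hε : ε = 1 ∨ ε = -1)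
    (hτc : ∀ n : ℕ, Squarefree n →
      (∀ q ∈ n.primeFactors, Zhang2014.IsKolyvaginPrime (W.conductorNorm ℤ) W K p q) →
      conjAct W c ((p ^ 1 : ℕ) : ℤ) ((d n).kolyvaginClass hp.out 1) =
        (ε * (-1) ^ n.primeFactors.card) • (d n).kolyvaginClass hp.out 1)
    (hfin : ∀ n : ℕ, Squarefree n →
      (∀ q ∈ n.primeFactors, Zhang2014.IsKolyvaginPrime (W.conductorNorm ℤ) W K p q) →
      ∀ v : HeightOneSpectrum (𝓞 K), (n : 𝓞 K) ∉ v.asIdeal →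
        (d n).kolyvaginClass hp.out 1 ∈
          selmerLocalKer (W.baseChange K) (v.adicCompletion K) ((p ^ 1 : ℕ) : ℤ))
    (hinf : ∀ n : ℕ, Squarefree n →
      (∀ q ∈ n.primeFactors, Zhang2014.IsKolyvaginPrime (W.conductorNorm ℤ) W K p q) →
      ∀ w : InfinitePlace K,
        (d n).kolyvaginClass hp.out 1 ∈ selmerLocalKer (W.baseChange K) w.Completion ((p ^ 1 : ℕ) : ℤ))
    (h44 : ∀ (ℓ m : ℕ), Squarefree (ℓ * m) →
      (∀ q ∈ (ℓ * m).primeFactors, Zhang2014.IsKolyvaginPrime (W.conductorNorm ℤ) W K p q) →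
      Zhang2014.IsKolyvaginPrime (W.conductorNorm ℤ) W K p ℓ →
      ∀ v : HeightOneSpectrum (𝓞 K), (ℓ : 𝓞 K) ∈ v.asIdeal →
        ((d (ℓ * m)).kolyvaginClass hp.out 1 ∈
            selmerLocalKer (W.baseChange K) (v.adicCompletion K) ((p ^ 1 : ℕ) : ℤ) ↔
          (d m).kolyvaginClass hp.out 1 ∈
            (W.baseChange K).torsionLocalKer (v.adicCompletion K) ((p ^ 1 : ℕ) : ℤ)))
    (hcyc : ∀ ℓ : ℕ, Zhang2014.IsKolyvaginPrime (W.conductorNorm ℤ) W K p ℓ →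
      ∀ e : ℤ, (e = 1 ∨ e = -1) →
      ∀ s₁ ∈ selmerGroup (W.baseChange K) ((p ^ 1 : ℕ) : ℤ),
        conjAct W c ((p ^ 1 : ℕ) : ℤ) s₁ = e • s₁ →
      ∀ s₂ ∈ selmerGroup (W.baseChange K) ((p ^ 1 : ℕ) : ℤ),
        conjAct W c ((p ^ 1 : ℕ) : ℤ) s₂ = e • s₂ →
      ∃ a b : ℤ, ¬ ((p : ℤ) ∣ a ∧ (p : ℤ) ∣ b) ∧
        ∀ v : HeightOneSpectrum (𝓞 K), (ℓ : 𝓞 K) ∈ v.asIdeal →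
          a • s₁ + b • s₂ ∈ (W.baseChange K).torsionLocalKer (v.adicCompletion K) ((p ^ 1 : ℕ) : ℤ))
    (hdual : ∀ (T : Finset ℕ), (∀ q ∈ T, Zhang2014.IsKolyvaginPrime (W.conductorNorm ℤ) W K p q) →
      ∀ ℓ ∈ T, ∀ e : ℤ, (e = 1 ∨ e = -1) →
      ∀ x : galH1Torsion (W.baseChange K) ((p ^ 1 : ℕ) : ℤ),
        conjAct W c ((p ^ 1 : ℕ) : ℤ) x = e • x →
        (∀ v : HeightOneSpectrum (𝓞 K), (∀ q ∈ T, (q : 𝓞 K) ∉ v.asIdeal) →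
          x ∈ selmerLocalKer (W.baseChange K) (v.adicCompletion K) ((p ^ 1 : ℕ) : ℤ)) →
        (∀ w : InfinitePlace K, x ∈ selmerLocalKer (W.baseChange K) w.Completion ((p ^ 1 : ℕ) : ℤ)) →
      ∀ s ∈ selmerGroup (W.baseChange K) ((p ^ 1 : ℕ) : ℤ),
        conjAct W c ((p ^ 1 : ℕ) : ℤ) s = e • s →
        (∀ q ∈ T, q ≠ ℓ → ∀ v : HeightOneSpectrum (𝓞 K), (q : 𝓞 K) ∈ v.asIdeal →
          s ∈ (W.baseChange K).torsionLocalKer (v.adicCompletion K) ((p ^ 1 : ℕ) : ℤ)) →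
        ∀ v : HeightOneSpectrum (𝓞 K), (ℓ : 𝓞 K) ∈ v.asIdeal →
          s ∉ (W.baseChange K).torsionLocalKer (v.adicCompletion K) ((p ^ 1 : ℕ) : ℤ) →
          x ∈ selmerLocalKer (W.baseChange K) (v.adicCompletion K) ((p ^ 1 : ℕ) : ℤ))
    {n₁ : ℕ} (hn₁ : Squarefree n₁)
    (hk₁ : ∀ q ∈ n₁.primeFactors, Zhang2014.IsKolyvaginPrime (W.conductorNorm ℤ) W K p q)
    (hne : (d n₁).kolyvaginClass hp.out 1 ≠ 0)
    (hrank : n₁.primeFactors.card + 1 ≤ W.mordellWeilRank) :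
    W.shaCorank p = 0 ∧ W.mordellWeilRank = n₁.primeFactors.card + 1 ∧
      (W.quadraticTwist (NumberField.discr K : ℚ)).mordellWeilRank ≤ n₁.primeFactors.card ∧
      Nat.card ↥(AddSubgroup.torsionBy W.toAffine.Point ((p ^ 1 : ℕ) : ℤ)) = 1 ∧
      W.sha ⊓ AddSubgroup.torsionBy W.galH1 ((p ^ 1 : ℕ) : ℤ) = ⊥ ∧
      Nat.card ↥(selmerGroup W ((p ^ 1 : ℕ) : ℤ)) = p ^ (n₁.primeFactors.card + 1) := by
  obtain ⟨S, hSel, hSp, hSc, hSK, hSτ⟩ := exists_hypothesesDepth_of_system hcm hK p hp2 htower c hc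
    hcc d ε hε hτc hfin hinf h44 hcyc hdual
  have hsupp : KolSupp S.Kol n₁ := by rw [hSK]; exact ⟨hn₁, hk₁⟩
  have hne' : S.c n₁ ≠ 0 := by rw [hSc]; exact hne
  exact door_of_hypothesesDepth W K hK.1 c hc p hp2 (pow_one p) S hSel hSp hSτ hsupp hne' hrank

/-- **The depth-table row on the crux's objects WITHOUT a twist point.** Same setting; the bit
`(d ℓ).kolyvaginClass hp 1 ≠ 0` at ONE Kolyvagin prime `ℓ` (Zhang's congruence form, as in the depth
table) and two independent points on `E(ℚ)` give `corank_{ℤ_p} Ш(E/ℚ)[p^∞] = 0`, `rank E(ℚ) = 2`,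
`rank E^{(d_K)}(ℚ) ≤ 1`, `E(ℚ)[p] = 0`, `Ш(E/ℚ)[p] = 0`, `#Sel_p(E/ℚ) = p²`. Compare g5's
`shaCorank_eq_zero_of_rank_two_of_kolyvaginClass_prime_ne_zero_of_system` (needs `1 ≤ rank E^{(d_K)}`).
CONDITIONAL on the displayed hypotheses; per-curve; BSD is not proved by it.
[cite: Kolyvagin1991MathAnn, Thm. 2.3] [cite: GrossLMS1991, §5 (5.1) and §10]
[cite: JetchevLauterStein2009, §3.6 (arXiv:0707.0032)] -/
theorem shaCorank_eq_zero_of_two_le_rank_of_kolyvaginClass_prime_ne_zero_of_system (hcm : ¬ W.HasCM)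
    (hK : IsImaginaryQuadratic K) (p : ℕ) [hp : Fact p.Prime] (hp2 : p ≠ 2)
    (htower : ∀ n : ℕ, W.HasSurjectiveModNGaloisRep (p ^ n : ℕ))
    (c : K ≃ₐ[ℚ] K) (hc : c ≠ 1) (hcc : c * c = 1)
    (d : ∀ n : ℕ, KolyvaginHeegnerData Dt β ι n) (ε : ℤ) (hε : ε = 1 ∨ ε = -1)
    (hτc : ∀ n : ℕ, Squarefree n →
      (∀ q ∈ n.primeFactors, Zhang2014.IsKolyvaginPrime (W.conductorNorm ℤ) W K p q) →
      conjAct W c ((p ^ 1 : ℕ) : ℤ) ((d n).kolyvaginClass hp.out 1) =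
        (ε * (-1) ^ n.primeFactors.card) • (d n).kolyvaginClass hp.out 1)
    (hfin : ∀ n : ℕ, Squarefree n →
      (∀ q ∈ n.primeFactors, Zhang2014.IsKolyvaginPrime (W.conductorNorm ℤ) W K p q) →
      ∀ v : HeightOneSpectrum (𝓞 K), (n : 𝓞 K) ∉ v.asIdeal →
        (d n).kolyvaginClass hp.out 1 ∈
          selmerLocalKer (W.baseChange K) (v.adicCompletion K) ((p ^ 1 : ℕ) : ℤ))
    (hinf : ∀ n : ℕ, Squarefree n →
      (∀ q ∈ n.primeFactors, Zhang2014.IsKolyvaginPrime (W.conductorNorm ℤ) W K p q) →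
      ∀ w : InfinitePlace K,
        (d n).kolyvaginClass hp.out 1 ∈ selmerLocalKer (W.baseChange K) w.Completion ((p ^ 1 : ℕ) : ℤ))
    (h44 : ∀ (ℓ m : ℕ), Squarefree (ℓ * m) →
      (∀ q ∈ (ℓ * m).primeFactors, Zhang2014.IsKolyvaginPrime (W.conductorNorm ℤ) W K p q) →
      Zhang2014.IsKolyvaginPrime (W.conductorNorm ℤ) W K p ℓ →
      ∀ v : HeightOneSpectrum (𝓞 K), (ℓ : 𝓞 K) ∈ v.asIdeal →
        ((d (ℓ * m)).kolyvaginClass hp.out 1 ∈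
            selmerLocalKer (W.baseChange K) (v.adicCompletion K) ((p ^ 1 : ℕ) : ℤ) ↔
          (d m).kolyvaginClass hp.out 1 ∈
            (W.baseChange K).torsionLocalKer (v.adicCompletion K) ((p ^ 1 : ℕ) : ℤ)))
    (hcyc : ∀ ℓ : ℕ, Zhang2014.IsKolyvaginPrime (W.conductorNorm ℤ) W K p ℓ →
      ∀ e : ℤ, (e = 1 ∨ e = -1) →
      ∀ s₁ ∈ selmerGroup (W.baseChange K) ((p ^ 1 : ℕ) : ℤ),
        conjAct W c ((p ^ 1 : ℕ) : ℤ) s₁ = e • s₁ →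
      ∀ s₂ ∈ selmerGroup (W.baseChange K) ((p ^ 1 : ℕ) : ℤ),
        conjAct W c ((p ^ 1 : ℕ) : ℤ) s₂ = e • s₂ →
      ∃ a b : ℤ, ¬ ((p : ℤ) ∣ a ∧ (p : ℤ) ∣ b) ∧
        ∀ v : HeightOneSpectrum (𝓞 K), (ℓ : 𝓞 K) ∈ v.asIdeal →
          a • s₁ + b • s₂ ∈ (W.baseChange K).torsionLocalKer (v.adicCompletion K) ((p ^ 1 : ℕ) : ℤ))
    (hdual : ∀ (T : Finset ℕ), (∀ q ∈ T, Zhang2014.IsKolyvaginPrime (W.conductorNorm ℤ) W K p q) →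
      ∀ ℓ ∈ T, ∀ e : ℤ, (e = 1 ∨ e = -1) →
      ∀ x : galH1Torsion (W.baseChange K) ((p ^ 1 : ℕ) : ℤ),
        conjAct W c ((p ^ 1 : ℕ) : ℤ) x = e • x →
        (∀ v : HeightOneSpectrum (𝓞 K), (∀ q ∈ T, (q : 𝓞 K) ∉ v.asIdeal) →
          x ∈ selmerLocalKer (W.baseChange K) (v.adicCompletion K) ((p ^ 1 : ℕ) : ℤ)) →
        (∀ w : InfinitePlace K, x ∈ selmerLocalKer (W.baseChange K) w.Completion ((p ^ 1 : ℕ) : ℤ)) →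
      ∀ s ∈ selmerGroup (W.baseChange K) ((p ^ 1 : ℕ) : ℤ),
        conjAct W c ((p ^ 1 : ℕ) : ℤ) s = e • s →
        (∀ q ∈ T, q ≠ ℓ → ∀ v : HeightOneSpectrum (𝓞 K), (q : 𝓞 K) ∈ v.asIdeal →
          s ∈ (W.baseChange K).torsionLocalKer (v.adicCompletion K) ((p ^ 1 : ℕ) : ℤ)) →
        ∀ v : HeightOneSpectrum (𝓞 K), (ℓ : 𝓞 K) ∈ v.asIdeal →
          s ∉ (W.baseChange K).torsionLocalKer (v.adicCompletion K) ((p ^ 1 : ℕ) : ℤ) →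
          x ∈ selmerLocalKer (W.baseChange K) (v.adicCompletion K) ((p ^ 1 : ℕ) : ℤ))
    {ℓ : ℕ} (hℓ : Zhang2014.IsKolyvaginPrime (W.conductorNorm ℤ) W K p ℓ)
    (hne : (d ℓ).kolyvaginClass hp.out 1 ≠ 0) (h2 : 2 ≤ W.mordellWeilRank) :
    W.shaCorank p = 0 ∧ W.mordellWeilRank = 2 ∧
      (W.quadraticTwist (NumberField.discr K : ℚ)).mordellWeilRank ≤ 1 ∧
      Nat.card ↥(AddSubgroup.torsionBy W.toAffine.Point ((p ^ 1 : ℕ) : ℤ)) = 1 ∧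
      W.sha ⊓ AddSubgroup.torsionBy W.galH1 ((p ^ 1 : ℕ) : ℤ) = ⊥ ∧
      Nat.card ↥(selmerGroup W ((p ^ 1 : ℕ) : ℤ)) = p ^ 2 := by
  have hcard : ℓ.primeFactors.card = 1 := by rw [hℓ.1.primeFactors, Finset.card_singleton]
  have h := shaCorank_eq_zero_of_kolyvaginClass_ne_zero_of_rank_le_of_system hcm hK p hp2 htower c
    hc hcc d ε hε hτc hfin hinf h44 hcyc hdual hℓ.1.squarefree (fun q hq ↦ by
      rw [hℓ.1.primeFactors, Finset.mem_singleton] at hq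
      exact hq ▸ hℓ) hne (by rw [hcard]; exact h2)
  rw [hcard] at h
  exact h

end System

/-! ## Every Euler-system input by name (McCallum 1991 facts for the concrete classes) -/

section Print

variable {W : WeierstrassCurve ℚ} [W.IsElliptic] [W.IsGloballyMinimal] [NeZero (W.conductorNorm ℤ)]
  {K : Type} [Field K] [NumberField K]
  {Dt : ModularParametrizationData W (W.conductorNorm ℤ)} {β : ℤ} {ι : K →+* ℂ}

/-- **The depth-table row without `hF`, without a twist point, all Euler-system inputs named.**
`E/ℚ` globally minimal without CM, `K` imaginary quadratic with `d_K ∉ {−3, −4}` and the Heegner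
hypothesis for `N_E`, `c` its complex conjugation, `p` an odd prime with `ρ̄_{E,p^n}` onto for all `n`,
a frame `(Dt, β, ι)` and a COMPATIBLE system `d n : KolyvaginHeegnerData Dt β ι n` (`hσ`, `hS₁`, `hS₂`,
`hemb`). Granted the named facts `sign_conjAct_kolyvaginClass` (Gross Prop. 5.4 (2)),
`lemma43_kolyvaginClass_mem_selmerLocalKer` (McCallum Lemma 4.3), `prop44_localOrder_kolyvaginClass_mul_eq`
(Prop. 4.4), `lemma53_selmer_eigen_dependent_at` (Lemma 5.3), `prop22_reciprocity_eigen_finset`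
(Prop. 2.2): ONE Kolyvagin prime `ℓ` with `(d ℓ).kolyvaginClass hp 1 ≠ 0` and `2 ≤ rank E(ℚ)` give
`corank_{ℤ_p} Ш(E/ℚ)[p^∞] = 0`, `rank E(ℚ) = 2`, `rank E^{(d_K)}(ℚ) ≤ 1`, `E(ℚ)[p] = 0`, `Ш(E/ℚ)[p] = 0`,
`#Sel_p(E/ℚ) = p²` — the proof of g5's `…_of_print` verbatim over the twist-free system door.
CONDITIONAL on the five named facts; per-curve; BSD is not proved by it.
[cite: Kolyvagin1991MathAnn, Thm. 2.3] [cite: McCallumLMS1991, §§2–5] [cite: GrossLMS1991, §10] -/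
theorem shaCorank_eq_zero_of_two_le_rank_of_kolyvaginClass_prime_ne_zero_of_print
    (h54 : sign_conjAct_kolyvaginClass) (h43 : lemma43_kolyvaginClass_mem_selmerLocalKer)
    (h44 : prop44_localOrder_kolyvaginClass_mul_eq) (h53 : lemma53_selmer_eigen_dependent_at)
    (h22 : prop22_reciprocity_eigen_finset)
    (hcm : ¬ W.HasCM) (hK : IsImaginaryQuadratic K) (hD3 : NumberField.discr K ≠ -3)
    (hD4 : NumberField.discr K ≠ -4) (hH : SatisfiesHeegnerHypothesis (W.conductorNorm ℤ) K)
    (p : ℕ) [hp : Fact p.Prime] (hp2 : p ≠ 2)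
    (htower : ∀ n : ℕ, W.HasSurjectiveModNGaloisRep (p ^ n : ℕ))
    (c : K ≃ₐ[ℚ] K) (hc : c ≠ 1) (hcc : c * c = 1)
    (d : ∀ n : ℕ, KolyvaginHeegnerData Dt β ι n)
    (hσ : ∀ (m l : ℕ), ∀ l' ∈ m.primeFactors, ∀ (x : ringClassField K ι m)
      (x' : ringClassField K ι (m * l)),
      (x : ℂ) = x' → (((d (m * l)).σ l' x' : ringClassField K ι (m * l)) : ℂ) = ((d m).σ l' x : ℂ))
    (hS₁ : ∀ (m l : ℕ), ∀ s ∈ (d m).S, ∃ s' ∈ (d (m * l)).S, ∀ (x : ringClassField K ι m)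
      (x' : ringClassField K ι (m * l)),
      (x : ℂ) = x' → ((s' x' : ringClassField K ι (m * l)) : ℂ) = (s x : ℂ))
    (hS₂ : ∀ (m l : ℕ), ∀ s' ∈ (d (m * l)).S, ∃ s ∈ (d m).S, ∀ (x : ringClassField K ι m)
      (x' : ringClassField K ι (m * l)),
      (x : ℂ) = x' → ((s' x' : ringClassField K ι (m * l)) : ℂ) = (s x : ℂ))
    (hemb : ∀ (m l : ℕ) (x : ringClassField K ι m) (x' : ringClassField K ι (m * l)),
      (x : ℂ) = x' → (d (m * l)).emb x' = (d m).emb x)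
    {ℓ : ℕ} (hℓ : Zhang2014.IsKolyvaginPrime (W.conductorNorm ℤ) W K p ℓ)
    (hne : (d ℓ).kolyvaginClass hp.out 1 ≠ 0) (h2 : 2 ≤ W.mordellWeilRank) :
    W.shaCorank p = 0 ∧ W.mordellWeilRank = 2 ∧
      (W.quadraticTwist (NumberField.discr K : ℚ)).mordellWeilRank ≤ 1 ∧
      Nat.card ↥(AddSubgroup.torsionBy W.toAffine.Point ((p ^ 1 : ℕ) : ℤ)) = 1 ∧
      W.sha ⊓ AddSubgroup.torsionBy W.galH1 ((p ^ 1 : ℕ) : ℤ) = ⊥ ∧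
      Nat.card ↥(selmerGroup W ((p ^ 1 : ℕ) : ℤ)) = p ^ 2 := by
  -- `ℓ' ∈ S₁(1)` for every Kolyvagin prime (Zhang's `0 < M(ℓ')`)
  have hS1 : ∀ {n : ℕ}, (∀ q ∈ n.primeFactors, Zhang2014.IsKolyvaginPrime (W.conductorNorm ℤ) W K p q) →
      ∀ q ∈ n.primeFactors, Zhang2014.IsKolyvaginPrime (W.conductorNorm ℤ) W K p q ∧
        1 ≤ Zhang2014.kolyvaginIndex W p q :=
    fun h q hq ↦ ⟨h q hq, (h q hq).2.2.2.2.2⟩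
  -- the sign law (Gross Prop. 5.4 (2))
  obtain ⟨ε, hε, hsign⟩ := h54 W hcm K hK hD3 hD4 hH p hp2 htower c hc Dt β ι 1 le_rfl
  refine shaCorank_eq_zero_of_two_le_rank_of_kolyvaginClass_prime_ne_zero_of_system hcm hK p hp2
    htower c hc hcc d ε hε (fun n hn hk ↦ hsign n hn (hS1 hk) (d n))
    (fun n hn hk v hv ↦ (h43 W hcm K hK hD3 hD4 hH p hp2 htower Dt β ι 1 le_rfl n hn (hS1 hk)
      (d n)).1 v hv)
    (fun n hn hk w ↦ (h43 W hcm K hK hD3 hD4 hH p hp2 htower Dt β ι 1 le_rfl n hn (hS1 hk)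
      (d n)).2 w)
    (fun l m hsq hk hl v hv ↦ ?_)
    (fun l hl e he s₁ hs₁ hτ₁ s₂ hs₂ hτ₂ ↦ h53 W hcm K hK p hp2 htower c hc 1 le_rfl l hl
      hl.2.2.2.2.2 e he s₁ hs₁ hτ₁ s₂ hs₂ hτ₂)
    (fun T hT l hlT e he x hx hoff hinf s hs hτs hsT v hv hsv ↦
      mem_selmerLocalKer_of_not_mem_torsionLocalKer_of_prop22 h22 W hcm K hK p hp2 htower c hc T hT
        hlT e he x hx hoff hinf s hs hτs hsT v hv hsv)
    hℓ hne h2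
  -- `h44`: McCallum Prop. 4.4 "in particular" for the compatible pair `(d m, d (m l))`
  have hsq' : Squarefree (m * l) := by rwa [Nat.mul_comm] at hsq
  have hk' : ∀ q ∈ (m * l).primeFactors, Zhang2014.IsKolyvaginPrime (W.conductorNorm ℤ) W K p q ∧
      1 ≤ Zhang2014.kolyvaginIndex W p q := by
    rw [Nat.mul_comm]
    exact hS1 hk
  have hlm : ¬ l ∣ m := by
    intro hdiv
    have hll : l * l ∣ l * m := Nat.mul_dvd_mul_left l hdiv
    exact hl.1.not_isUnit (hsq l hll)
  have hA := kolyvaginClass_mul_mem_selmerLocalKer_iff_of_prop44 h44 W hcm K hK hD3 hD4 hH p hp2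
    htower Dt β ι 1 le_rfl m l hsq' hl.1 hlm hk' (d m) (d (m * l)) (hσ m l) (hS₁ m l) (hS₂ m l)
    (hemb m l) v hv
  have hB := kolyvaginClass_mul_mem_torsionLocalKer_iff_of_prop44 h44 W hcm K hK hD3 hD4 hH p hp2
    htower Dt β ι 1 le_rfl m l hsq' hl.1 hlm hk' (d m) (d (m * l)) (hσ m l) (hS₁ m l) (hS₂ m l)
    (hemb m l) v hv
  have hAB : (d (m * l)).kolyvaginClass (Fact.out : p.Prime) 1 ∈
        selmerLocalKer (W.baseChange K) (v.adicCompletion K) ((p ^ 1 : ℕ) : ℤ) ↔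
      (d m).kolyvaginClass (Fact.out : p.Prime) 1 ∈
        (W.baseChange K).torsionLocalKer (v.adicCompletion K) ((p ^ 1 : ℕ) : ℤ) := hA.trans hB
  rw [Nat.mul_comm m l] at hAB
  exact hAB

end Print

end Summit.BirchSwinnertonDyer.BirchSwinnertonDyer.Theorems.KolyvaginDepthDoor

end
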